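import Summits.ABC.IUTFork.Cor312GenuineThetaIdentification
import Summits.ABC.IUTFork.Cor312FrameVolumePiecesM
import Summits.ABC.IUTFork.Cor312ThetaSideReduction
import Summits.ABC.IUTFork.LDHGenuineSupportLoc
import HarnessLib

/-!
# [IUTchIII] Corollary 3.12 — G1-Θ ASSEMBLED at the M level: the Θ-side identification `−|log(Θ)| ≤ ↑(genuine −|log(Θ)|)`
# for ANY typed setting over the initial Θ-data's index skeleton, FROM three local inputs (unit P6-final of
# `HOME/staging/w5/w5-d166/g4/G1-THETA-SHAPES.md`)

PROOF-ONLY record file (D-0012; one auxiliary data definition `orbitSumM`, no `Prop` facts) of the abc-iut cell (seat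
abc-iut-w5-d166, gen 4; branch C «abc ⇐ S», C-lead ruling C-R12 (e) «target #2′: the M-level (V̲, K_{v̲}) real volume
setting»). TAKES NO SIDE on [IUTchIII] Cor. 3.12.

The READ binder `hΘ` of the branch-C certificates (`Conditional/AbcOfS*.lean`: «the setting's `−|log(Θ)|`, when finite, is at
most the datum's defined `−|log(Θ)|`») is, for a setting `P` over abc-iut-c312-5's M-level skeleton `Real.thetaIndexOfInitial D`
([IUTchI] Def. 3.1 (e): `V := V̲`, `V_ℚ := V(ℚ)`; `Thm311RealM`) and the genuine Θ-volume input `volumeInputOf D r` of idele data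
`r` (abc-iut-S2 `InitialThetaDataVolume`, `GenuineLogTheta`: `negLogTheta = Σ_{p ∈ T(I)} negLogThetaLoc p + ((l+5)/4)·log π`),
REDUCED here to three LOCAL statements about `P` — exactly the outputs of units P5 (`HullDefined`/lower bound) and (U1)-HULL
(abc-iut-s2-p7's orbit-hull bound) at the assembled M-level settings (frames route `settingMSharp` p435453 / summand route
`settingPrVolSharpM`, abc-iut-s2-p8 over abc-iut-w4-d013's p435693):

* (h∞) at the archimedean place every local Θ-volume is `0` (trivial archimedean container of the cell's real settings);
* (hA) at every finite place `u` of `ℚ` and label `i+1`, the local Θ-volume is at most the ORBIT SUM `orbitSumM D r i u` :=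
  `Σ_{v⃗' : S^±_{i+2} → V̲_u} Pr(v⃗')·log μ̄(hull of the (Ind2)-orbit of the slot union ⋃_a ι_a(t_{Θ,i,v̲'_a})·(R_I)^∼)` over
  unit P1's presentation (p433804) with unit P4a's ideles (abc-iut-w5-d033 `tThetaM`, p436273) — the shape of [IUTchIV]
  Thm. 1.10 Step (v) and of SHAPES (U1) ((Ind1)/(Ind2) map the log-shell lattice packets onto themselves, so the hull of all
  possible images lies in the pulled-back product of the summandwise orbit hulls);
* (hlow) at a finite place `u` whose prime lies OUTSIDE the support `T(I)` ([IUTchIV] Step (vi): odd, unramified in `K`, prime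
  to the bad places — unit ideles) the local Θ-volume is `≥ 0` (it contains the unit region).

THEN (`negLogTheta_le_genuine_of_local_bounds`): **`P.negLogTheta ≤ ↑(volumeInputOf D r).negLogTheta`**. Proof: unit P6-ident
(`procAvg_sum_fibre_weightM_orbitHull_eq_negLogThetaLoc`, p437565): the procession average of the orbit sums at `u ∋ p` IS
abc-iut-S2's `negLogThetaLoc p`; abc-iut-c312-3's Step (vi) `negLogThetaLoc_eq_zero_of_not_mem` (p ∉ T(I) ⇒ `0`) with (hA)/(hlow)
forces every local Θ-volume off `T(I)` to vanish; unit (R) `negLogTheta_le_sum_add` (p432344) sums the bounds over the finite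
set of places of `ℚ` under `T(I)` (`placeOfPrimeQ`, one place per prime) and adds the archimedean closed form
`archLogTheta > 0` (abc-iut-S2 `archLogTheta_pos`; invisible to the setting's trivial archimedean container — whence `≤`, never `=`,
as scoped by abc-iut-C-cert-1 06:57:03Z).
[cite: Mochizuki2012, IUTchIII Cor. 3.12 p. 173–174] [cite: Mochizuki2012, IUTchIV Thm. 1.10 Steps (v)–(viii) p. 27–30]
[cite: DupuyHilado2025, Def. 3.6.3, §4.11–4.12] [claim: Mochizuki2012, status: disputed] for the quoted notions.
HONEST FRAMING: a comparison between OUR two typings of one printed quantity, conditional on the three named local inputs;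
nothing here bears on the truth of [IUTchIII] Cor. 3.12; typed ≠ proved; instantiated ≠ endorsed.
-/

noncomputable section

open Set Function NumberField IsDedekindDomain
open scoped Pointwise Classical

namespace Summit.ABC.IUTFork.Thm311.Real

open Cor312 Cor312Vol Literature.IUT.LogThetaLattice Literature.IUT.LogVolume Literature.IUT.HodgeTheaters
  Literature.NumberTheory.NumberFields

/-! ## §1. One finite place of `ℚ` per prime -/

/-- A rational prime is not a unit of `𝓞_ℚ = ℤ`. [folklore] -/
theorem not_isUnit_natCast_ringOfIntegers_rat {p : ℕ} (hp : p.Prime) : ¬ IsUnit ((p : ℕ) : 𝓞 ℚ) := by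
  intro h
  have h' : IsUnit (Rat.ringOfIntegersEquiv ((p : ℕ) : 𝓞 ℚ)) := h.map _
  rw [map_natCast, Int.isUnit_iff] at h'
  rcases h' with h1 | h1
  · exact hp.one_lt.ne' (by exact_mod_cast h1)
  · have : (0 : ℤ) ≤ (p : ℤ) := Int.natCast_nonneg p
    omega

/-- A maximal ideal of `𝓞_ℚ` containing the prime `p` (Krull). [folklore] -/
theorem exists_maximal_natCast_mem {p : ℕ} (hp : p.Prime) :
    ∃ m : Ideal (𝓞 ℚ), m.IsMaximal ∧ ((p : ℕ) : 𝓞 ℚ) ∈ m := by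
  obtain ⟨m, hm, hle⟩ := Ideal.exists_le_maximal _
    (Ideal.span_singleton_ne_top (not_isUnit_natCast_ringOfIntegers_rat hp))
  exact ⟨m, hm, hle (Ideal.mem_span_singleton_self _)⟩

/-- The height-one prime of `𝓞_ℚ` at the prime `p`. [folklore] -/
def primeSpecQ (p : ℕ) (hp : p.Prime) : HeightOneSpectrum (𝓞 ℚ) where
  asIdeal := (exists_maximal_natCast_mem hp).choose
  isPrime := (exists_maximal_natCast_mem hp).choose_spec.1.isPrime
  ne_bot h0 := by
    have hmem := (exists_maximal_natCast_mem hp).choose_spec.2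
    rw [h0, Ideal.mem_bot] at hmem
    exact hp.ne_zero (by exact_mod_cast hmem)

/-- `p ∈ 𝔭_p`. [folklore] -/
theorem natCast_mem_primeSpecQ (p : ℕ) (hp : p.Prime) : ((p : ℕ) : 𝓞 ℚ) ∈ (primeSpecQ p hp).asIdeal :=
  (exists_maximal_natCast_mem hp).choose_spec.2

/-- **The finite place of `ℚ` at the prime `p`.** [folklore] -/
def placeOfPrimeQ (p : ℕ) (hp : p.Prime) : FinitePlace ℚ := FinitePlace.mk (primeSpecQ p hp)

/-- `p ∈ 𝔭_{u_p}`. [folklore] -/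
theorem natCast_mem_placeOfPrimeQ (p : ℕ) (hp : p.Prime) :
    ((p : ℕ) : 𝓞 ℚ) ∈ (FinitePlace.maximalIdeal (placeOfPrimeQ p hp)).asIdeal := by
  unfold placeOfPrimeQ
  rw [FinitePlace.maximalIdeal_mk]
  exact natCast_mem_primeSpecQ p hp

/-- The prime of the place at `p` is `p`. [folklore] -/
theorem ratChar_placeOfPrimeQ (p : ℕ) (hp : p.Prime) : ratChar (placeOfPrimeQ p hp) = p :=
  haveI : Fact p.Prime := ⟨hp⟩
  residueChar_eq_of_natCast_mem p (natCast_mem_placeOfPrimeQ p hp)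

/-- A finite place of `ℚ` IS the place at its prime (two places containing the same prime coincide: abc-iut-w5-d033
`heightOneSpectrum_rat_eq_of_natCast_mem`). [folklore] -/
theorem placeOfPrimeQ_ratChar (u : FinitePlace ℚ) : placeOfPrimeQ (ratChar u) (fact_ratChar_prime u).out = u := by
  have h : primeSpecQ (ratChar u) (fact_ratChar_prime u).out = FinitePlace.maximalIdeal u :=
    heightOneSpectrum_rat_eq_of_natCast_mem (p := ratChar u) (natCast_mem_primeSpecQ (ratChar u) _)
      (natCast_ratChar_mem u)
  unfold placeOfPrimeQ
  rw [h, FinitePlace.mk_maximalIdeal]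

variable {F K Fbar : Type} [Field F] [NumberField F] [Field K] [NumberField K] [Algebra F K]
  [Field Fbar] [Algebra F Fbar] [Algebra K Fbar] {E : WeierstrassCurve F} [E.IsElliptic] {l : ℕ}
  {Pb : BadPlacePredicates K} (D : InitialThetaData F K Fbar E l Pb) (r : ThetaData.IdeleData D)

/-! ## §2. The orbit sums -/

/-- **The ORBIT SUM at `(i+1, u)`**: `Σ_{v⃗' : S^±_{i+2} → V̲_u} Pr(v⃗')·log μ̄_{v⃗'}(hull of the (Ind2)-orbit of the slot union
⋃_a ι_a(t_{Θ,i,v̲'_a})·(R_I)^∼)` over unit P1's presentation at `p = p_u` with unit P4a's ideles — the right-hand side of the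
setting-side hull bound (SHAPES (U1); [IUTchIV] Thm. 1.10 Step (v)) and the left-hand side of unit P6-ident.
[cite: Mochizuki2012, IUTchIV Thm. 1.10 Step (v) p. 27–28] -/
def orbitSumM (i : Fin (thetaIndexOfInitial D).lstar) (u : FinitePlace ℚ) : ℝ :=
  letI : Fintype ((thetaIndexOfInitial D).Fibre (Val.non u)) := Fintype.ofFinite _
  ∑ e' : Fin ((i : ℕ) + 1 + 1) → (thetaIndexOfInitial D).Fibre (Val.non u),
    weightM D u (Fin.succ i) e' *
      packetLogμ (ratChar u) (fun b => kOfM D (ratChar u) u (natCast_ratChar_mem u) (e' b))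
        (packetHull (ratChar u) (fun b => kOfM D (ratChar u) u (natCast_ratChar_mem u) (e' b))
          (⋃ g : indTwo (ratChar u) (fun b => kOfM D (ratChar u) u (natCast_ratChar_mem u) (e' b)),
            g • ⋃ a : Fin ((i : ℕ) + 1 + 1),
              iota (ratChar u) (fun b => kOfM D (ratChar u) u (natCast_ratChar_mem u) (e' b)) a
                  (tThetaM D (ratChar u) u (natCast_ratChar_mem u) r i (e' a)) •
                (normalizedPacket (ratChar u) (fun b => kOfM D (ratChar u) u (natCast_ratChar_mem u) (e' b)) :
                  Set (PacketAlgebra (ratChar u) (fun b => kOfM D (ratChar u) u (natCast_ratChar_mem u) (e' b))))))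

/-- **The procession average of the orbit sums at `u` IS abc-iut-S2's `negLogThetaLoc p_u`** (unit P6-ident at `p = p_u`).
[cite: DupuyHilado2025, Def. 3.6.3, §4.11–4.12] -/
theorem procAvg_orbitSumM_eq_negLogThetaLoc (u : FinitePlace ℚ) :
    (1 / ((thetaIndexOfInitial D).lstar : ℝ)) * ∑ i : Fin (thetaIndexOfInitial D).lstar, orbitSumM D r i u =
      (ThetaData.volumeInputOf D r).negLogThetaLoc (ratChar u) := by
  letI : Fintype ((thetaIndexOfInitial D).Fibre (Val.non u)) := Fintype.ofFinite _
  unfold orbitSumM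
  exact procAvg_sum_fibre_weightM_orbitHull_eq_negLogThetaLoc D (ratChar u) u (natCast_ratChar_mem u) r

/-- Off the support `T(I)` the procession average of the orbit sums vanishes ([IUTchIV] Step (vi) for the genuine input:
abc-iut-c312-3 `negLogThetaLoc_eq_zero_of_not_mem`). [cite: Mochizuki2012, IUTchIV Thm. 1.10 Step (vi) p. 29] -/
theorem sum_orbitSumM_eq_zero_of_not_mem (u : FinitePlace ℚ)
    (hu : ratChar u ∉ (ThetaData.volumeInputOf D r).supportPrimes) :
    ∑ i : Fin (thetaIndexOfInitial D).lstar, orbitSumM D r i u = 0 := by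
  have h := procAvg_orbitSumM_eq_negLogThetaLoc D r u
  rw [DHData.negLogThetaLoc_eq_zero_of_not_mem _ (fact_ratChar_prime u).out hu] at h
  have hl : (1 / ((thetaIndexOfInitial D).lstar : ℝ)) ≠ 0 :=
    one_div_ne_zero (Cor312.Setting.lstar_cast_pos (T := thetaIndexOfInitial D)).ne'
  rcases mul_eq_zero.mp h with h0 | h0
  · exact absurd h0 hl
  · exact h0

/-! ## §3. The assembly -/

variable {S : Situation (thetaIndexOfInitial D)} (P : Cor312.Setting S)

/-- **Vanishing off the support from the three local inputs**: at a finite place whose prime lies outside `T(I)`, local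
Θ-volumes squeezed between `0` (hlow) and orbit sums (hA) whose total is `0` are all `0`.
[cite: Mochizuki2012, IUTchIV Thm. 1.10 Step (vi) p. 29] -/
theorem thetaLocal_eq_zero_of_not_mem_support (u : FinitePlace ℚ)
    (hu : ratChar u ∉ (ThetaData.volumeInputOf D r).supportPrimes)
    (hA : ∀ i : Fin (thetaIndexOfInitial D).lstar,
      P.thetaLocal (Cor312.Setting.labelSucc i) (Val.non u) ≤ ((orbitSumM D r i u : ℝ) : WithTop ℝ))
    (hlow : ∀ i : Fin (thetaIndexOfInitial D).lstar,
      ((0 : ℝ) : WithTop ℝ) ≤ P.thetaLocal (Cor312.Setting.labelSucc i) (Val.non u))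
    (i : Fin (thetaIndexOfInitial D).lstar) :
    P.thetaLocal (Cor312.Setting.labelSucc i) (Val.non u) = ((0 : ℝ) : WithTop ℝ) := by
  -- every local volume is a real number `x_i` with `0 ≤ x_i ≤ orbitSumM i`
  have hx : ∀ i', ∃ x : ℝ, P.thetaLocal (Cor312.Setting.labelSucc i') (Val.non u) = (x : WithTop ℝ) ∧
      0 ≤ x ∧ x ≤ orbitSumM D r i' u := by
    intro i'
    have hne : P.thetaLocal (Cor312.Setting.labelSucc i') (Val.non u) ≠ ⊤ :=
      ne_top_of_le_ne_top WithTop.coe_ne_top (hA i')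
    obtain ⟨x, hxe⟩ := WithTop.ne_top_iff_exists.mp hne
    refine ⟨x, hxe.symm, ?_, ?_⟩
    · have := hlow i'; rw [← hxe] at this; exact WithTop.coe_le_coe.mp this
    · have := hA i'; rw [← hxe] at this; exact WithTop.coe_le_coe.mp this
  choose x hx0 hx1 hx2 using hx
  -- the orbit sums are `≥ x_i ≥ 0` and add up to `0`, hence vanish; so does `x_i`
  have hsum := sum_orbitSumM_eq_zero_of_not_mem D r u hu
  have hnonneg : ∀ i' ∈ (Finset.univ : Finset (Fin (thetaIndexOfInitial D).lstar)), 0 ≤ orbitSumM D r i' u :=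
    fun i' _ => (hx1 i').trans (hx2 i')
  have hzero := (Finset.sum_eq_zero_iff_of_nonneg hnonneg).mp hsum i (Finset.mem_univ i)
  have hxi : x i = 0 := le_antisymm ((hx2 i).trans hzero.le) (hx1 i)
  rw [hx0 i, hxi]

/-- **G1-Θ ASSEMBLED at the M level.** For ANY setting `P` of [IUTchIII] Cor. 3.12 over the index skeleton of the initial
Θ-data `D` and the genuine Θ-volume input of idele data `r`: if (h∞) the local Θ-volumes vanish at the archimedean place,
(hA) are bounded by the orbit sums at every finite place and label, and (hlow) are nonnegative at the finite places outside
the support `T(I)`, then the typed `−|log(Θ)|` of `P` is at most abc-iut-S2's genuine number: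
`P.negLogTheta ≤ ↑(volumeInputOf D r).negLogTheta` — the READ binder `hΘ` of the branch-C certificates at `P`, in its honest
one-sided form. [cite: Mochizuki2012, IUTchIII Cor. 3.12 p. 173–174] -/
theorem negLogTheta_le_genuine_of_local_bounds
    (harc : ∀ (i : Fin (thetaIndexOfInitial D).lstar) (w : InfinitePlace ℚ),
      P.thetaLocal (Cor312.Setting.labelSucc i) (Val.arc w) = ((0 : ℝ) : WithTop ℝ))
    (hA : ∀ (i : Fin (thetaIndexOfInitial D).lstar) (u : FinitePlace ℚ),
      P.thetaLocal (Cor312.Setting.labelSucc i) (Val.non u) ≤ ((orbitSumM D r i u : ℝ) : WithTop ℝ))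
    (hlow : ∀ (i : Fin (thetaIndexOfInitial D).lstar) (u : FinitePlace ℚ),
      ratChar u ∉ (ThetaData.volumeInputOf D r).supportPrimes →
        ((0 : ℝ) : WithTop ℝ) ≤ P.thetaLocal (Cor312.Setting.labelSucc i) (Val.non u)) :
    P.negLogTheta ≤ (((ThetaData.volumeInputOf D r).negLogTheta : ℝ) : WithTop ℝ) := by
  set I := ThetaData.volumeInputOf D r with hI
  -- the finite set of places of `ℚ` under the support, one per prime
  let φ : {q // q ∈ I.supportPrimes} → (thetaIndexOfInitial D).VQ :=
    fun q => Val.non (placeOfPrimeQ q.1 (I.prime_of_mem_supportPrimes q.2))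
  have hφ : Function.Injective φ := by
    intro q q' h
    have h1 : placeOfPrimeQ q.1 (I.prime_of_mem_supportPrimes q.2) =
        placeOfPrimeQ q'.1 (I.prime_of_mem_supportPrimes q'.2) := Sum.inr_injective h
    apply Subtype.ext
    rw [← ratChar_placeOfPrimeQ q.1 (I.prime_of_mem_supportPrimes q.2), h1,
      ratChar_placeOfPrimeQ q'.1 (I.prime_of_mem_supportPrimes q'.2)]
  let Tset : Finset (thetaIndexOfInitial D).VQ := Finset.univ.image φ
  -- the local bounds: orbit sums at finite places, `0` at the archimedean place
  let b : Fin (thetaIndexOfInitial D).lstar → (thetaIndexOfInitial D).VQ → ℝ := fun i vQ =>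
    match vQ with
    | .inr u => orbitSumM D r i u
    | .inl _ => 0
  have hle : ∀ (i : Fin (thetaIndexOfInitial D).lstar), ∀ vQ ∈ Tset,
      P.thetaLocal (Cor312.Setting.labelSucc i) vQ ≤ ((b i vQ : ℝ) : WithTop ℝ) := by
    intro i vQ hvQ
    obtain ⟨q, -, rfl⟩ := Finset.mem_image.mp hvQ
    exact hA i _
  have hzero : ∀ (i : Fin (thetaIndexOfInitial D).lstar) (vQ : (thetaIndexOfInitial D).VQ), vQ ∉ Tset →
      P.thetaLocal (Cor312.Setting.labelSucc i) vQ = ((0 : ℝ) : WithTop ℝ) := by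
    intro i vQ hvQ
    rcases vQ with w | u
    · exact harc i w
    · have hu : ratChar u ∉ I.supportPrimes := by
        intro hmem
        apply hvQ
        refine Finset.mem_image.mpr ⟨⟨ratChar u, hmem⟩, Finset.mem_univ _, ?_⟩
        show Val.non (placeOfPrimeQ (ratChar u) _) = Val.non u
        rw [placeOfPrimeQ_ratChar u]
      exact thetaLocal_eq_zero_of_not_mem_support D r P u hu (fun i' => hA i' u) (fun i' => hlow i' u hu) i
  have hmain := P.negLogTheta_le_sum_add Tset b (ThetaVolumeInput.archLogTheta_pos I.l).le hzero hle
  -- the place sum of the averaged orbit sums is the nonarchimedean part of the genuine number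
  have hsum : (∑ vQ ∈ Tset, (1 / ((thetaIndexOfInitial D).lstar : ℝ)) * ∑ i : Fin (thetaIndexOfInitial D).lstar, b i vQ) =
      I.negLogThetaNonarch := by
    rw [Finset.sum_image fun q _ q' _ h => hφ h, ThetaVolumeInput.negLogThetaNonarch,
      ← Finset.sum_attach I.supportPrimes]
    refine Finset.sum_congr rfl fun q _ => ?_
    show (1 / ((thetaIndexOfInitial D).lstar : ℝ)) *
        ∑ i, orbitSumM D r i (placeOfPrimeQ q.1 (I.prime_of_mem_supportPrimes q.2)) = I.negLogThetaLoc q.1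
    rw [procAvg_orbitSumM_eq_negLogThetaLoc, ratChar_placeOfPrimeQ]
  rw [hsum] at hmain
  exact hmain

end Summit.ABC.IUTFork.Thm311.Real

end
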